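import Summits.ABC.StewartYu.ArchG3RecLinesE
import Summits.ABC.StewartYu.ArchG3RecLinesCK
import HarnessLib

/-!
# `ArchG3Rec` O-FAMILY letter lines (odd-node k-step `(lev,0) → (lev,1)`, `lev ≥ 1`) — ATOMS A: currencies, the odd-node schedule letters,
# the κ-free pivot box, the `log`-algebra of `DΔC`/`WC`, and `cUR` in the unit `Z`

Support file (theorems only; no named facts).  Cell `abc-stewartyu` (HOME `run/shared/lean/pub/abc-stewartyu/`), route `YuMatveevShapeRat`
(rung A1.L), crux r2 `ArchCoreRat` (stmt-ABC-20502), line `arch-g3-frame`, seam (B) of the last open stub `stub_recLinesArch`, plan R50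
assignment «O (odd step): (J)+(C)+smallness → p2» (seat p2 g8).  Unit `Z = G·X·L`; p1's letter sheet `ArchG3RecLinesA–E`, p4's κ-twins
`ArchG3RecLinesCK`; every helper of this family carries the suffix `O` (no collision with the other families' files).

* `currenciesO/'` — `L ≤ Z/(512(n+1)²)`, `X·L = Z/G`, `L·WN ≤ Z/(64(n+1))`, `(n+1)·X·L = Z/8`, coarse forms (`Z ≥ 4608`);
* `T_realO`, `Nh_realO` (`Nh·(T+1) ≤ 4XL + T + 1`, the capped schedule), `weights_Nh_leO` (`γb lev·Nh lev, wl lev·Nh lev ≤ X·L` for `lev ≥ 1`);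
* `LbRK_last_leO` — at the pivot the κ-radius has no tail: `sRRK κ jl = 2Bv jl + 3`, `LbRK κ lev jl ≤ 3NL + 6`; `log_box_range_leO`;
* `log_DΔC_eqO`, `log_WC_eqO` (pure algebra on p5's sizes); `cUR_le_ZO` (`cUR ≤ Z/40`, from p1's `cUR_le`).

WHAT THIS IS NOT: any line of the family (files `ArchG3RecLinesOAtomsB/C`, `ArchG3RecLinesO`); no crux moves.

## References
* [Nesterenko2003] Yu. V. Nesterenko, LNM 1819 (2003) — §4.2 (4.24)–(4.35) with the odd nodes `𝒳_{s,0}`, p. 87–90; §3.5 (3.22)–(3.25),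
  Lemma 3.10 (3.35), Lemma 3.11 (3.42), (3.37).
-/

noncomputable section

open Finset Real
open scoped Nat
open Summit.ABC.StewartYu.ArchSupply (WC)
open Summit.ABC.StewartYu.ArchG3Setup (DΔC)

namespace Summit.ABC.StewartYu

/-! ### Three numerical logarithms -/

/-- `log 10 ≤ 3` (`10 ≤ e³`). [folklore] -/
theorem log_ten_le_threeO : Real.log 10 ≤ 3 := by
  have he := Real.exp_one_gt_d9
  have h : (10 : ℝ) ≤ Real.exp 3 := by
    have e3 : Real.exp 1 ^ 3 = Real.exp 3 := by rw [Real.exp_one_pow]; norm_num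
    have hp : (2.7182818283 : ℝ) ^ 3 ≤ Real.exp 1 ^ 3 := pow_le_pow_left₀ (by norm_num) he.le 3
    have hc : (10 : ℝ) ≤ (2.7182818283 : ℝ) ^ 3 := by norm_num
    rw [← e3]; linarith
  calc Real.log 10 ≤ Real.log (Real.exp 3) := Real.log_le_log (by norm_num) h
    _ = 3 := Real.log_exp 3

/-- `log 20 ≤ 3` (`20 ≤ e³ = 20.08…`). [folklore] -/
theorem log_twenty_le_threeO : Real.log 20 ≤ 3 := by
  have he := Real.exp_one_gt_d9
  have h : (20 : ℝ) ≤ Real.exp 3 := by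
    have e3 : Real.exp 1 ^ 3 = Real.exp 3 := by rw [Real.exp_one_pow]; norm_num
    have hp : (2.7182818283 : ℝ) ^ 3 ≤ Real.exp 1 ^ 3 := pow_le_pow_left₀ (by norm_num) he.le 3
    have hc : (20 : ℝ) ≤ (2.7182818283 : ℝ) ^ 3 := by norm_num
    rw [← e3]; linarith
  calc Real.log 20 ≤ Real.log (Real.exp 3) := Real.log_le_log (by norm_num) h
    _ = 3 := Real.log_exp 3

namespace ArchG3Rec

open PadicG3Par (Cb Cb_pos)
open ArchG3Par (G K yloadK G_eq G_pos K_pos yloadK_pos)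

variable {n : ℕ} (P : ArchG3Rec n)

/-- the four currenciesO: `L ≤ Z/(512(n+1)²)`, `X·L = Z/G`, `L·WN ≤ Z/(64(n+1))`, `(n+1)·X·L = Z/8`; and `0 < Z`, `24 ≤ G` (`n ≥ 2`).
[folklore] -/
theorem currenciesO (hn : 2 ≤ n) :
    0 < P.Z ∧ (P.L : ℝ) ≤ P.Z / (512 * ((n : ℝ) + 1) ^ 2) ∧ (P.X : ℝ) * P.L = P.Z / G n ∧
      (P.L : ℝ) * P.WN ≤ P.Z / (64 * ((n : ℝ) + 1)) ∧ ((n : ℝ) + 1) * (P.X * P.L) = P.Z / 8 ∧ (24 : ℝ) ≤ G n := by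
  obtain ⟨hZ, hLW, hL, hXL⟩ := P.Z_floors
  have hn' : (2 : ℝ) ≤ n := by exact_mod_cast hn
  have hG : G n = 8 * (n + 1) := G_eq n
  have hn1 : (0 : ℝ) < (n : ℝ) + 1 := by positivity
  refine ⟨hZ, ?_, hXL, ?_, ?_, by rw [hG]; linarith⟩
  · rw [le_div_iff₀ (by positivity)]; linarith
  · rw [le_div_iff₀ (by positivity)]; linarith
  · rw [hXL, hG]; field_simp

/-- coarse currenciesO: `L ≤ Z/4608`, `X·L ≤ Z/24`, `X ≤ Z/24`, `L·WN ≤ Z/192`, `WN ≤ Z/192`, `1 ≤ Z`. [folklore] -/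
theorem currenciesO' (hn : 2 ≤ n) :
    (P.L : ℝ) ≤ P.Z / 4608 ∧ (P.X : ℝ) * P.L ≤ P.Z / 24 ∧ (P.X : ℝ) ≤ P.Z / 24 ∧ (P.L : ℝ) * P.WN ≤ P.Z / 192 ∧
      P.WN ≤ P.Z / 192 ∧ 4608 ≤ P.Z := by
  obtain ⟨hZ, hL, hXL, hLW, -, hG⟩ := P.currenciesO hn
  have hn' : (2 : ℝ) ≤ n := by exact_mod_cast hn
  have hL1 := P.L_real.1
  have hX := P.X_floors.2.1
  have hWN := P.WN_bounds.1
  have h1 : (P.L : ℝ) ≤ P.Z / 4608 := by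
    refine hL.trans ?_
    rw [div_le_div_iff_of_pos_left hZ (by positivity) (by norm_num)]; nlinarith
  have h2 : (P.X : ℝ) * P.L ≤ P.Z / 24 := by
    rw [hXL]; exact div_le_div_of_nonneg_left hZ.le (by norm_num) hG
  have h3 : (P.X : ℝ) ≤ P.Z / 24 := le_trans (by nlinarith) h2
  have h4 : (P.L : ℝ) * P.WN ≤ P.Z / 192 := by
    refine hLW.trans ?_
    rw [div_le_div_iff_of_pos_left hZ (by positivity) (by norm_num)]; nlinarith
  have h5 : P.WN ≤ P.Z / 192 := le_trans (by nlinarith) h4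
  exact ⟨h1, h2, h3, h4, h5, by nlinarith⟩

/-- the order drop in `ℝ`: `1 ≤ T lev ≤ 8L` and `T lev ≤ 8L/2^lev + 1`. [folklore] -/
theorem T_realO (lev : ℕ) : (1 : ℝ) ≤ P.T lev ∧ (P.T lev : ℝ) ≤ 8 * P.L ∧ (P.T lev : ℝ) ≤ 8 * (P.L : ℝ) / 2 ^ lev + 1 := by
  obtain ⟨h1, h8, -⟩ := P.T_facts lev
  refine ⟨by exact_mod_cast h1, by exact_mod_cast h8, ?_⟩
  unfold T
  rcases le_total 1 (8 * P.L / 2 ^ lev) with h | h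
  · rw [max_eq_right h]
    have : ((8 * P.L / 2 ^ lev : ℕ) : ℝ) ≤ 8 * (P.L : ℝ) / 2 ^ lev := by
      rw [le_div_iff₀ (by positivity)]; exact_mod_cast Nat.div_mul_le_self (8 * P.L) (2 ^ lev)
    linarith
  · rw [max_eq_left h]; push_cast
    have : (0 : ℝ) ≤ 8 * (P.L : ℝ) / 2 ^ lev := by positivity
    linarith

/-- the odd nodes in `ℝ`: `1 ≤ Nh lev = Xs lev ≤ 2^lev·X/2 + 1`, `Nf lev 1 = 2·Nh lev`, and the cap `Nh lev·(T lev + 1) ≤ 4·X·L + T lev + 1`.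
[cite: Nesterenko2003, (4.3); shape only] -/
theorem Nh_realO (lev : ℕ) : (1 : ℝ) ≤ P.Nh lev ∧ (P.Nh lev : ℝ) ≤ 2 ^ lev * P.X / 2 + 1 ∧ (P.Nf lev 1 : ℝ) = 2 * P.Nh lev ∧
    (P.Nh lev : ℝ) * (P.T lev + 1) ≤ 4 * P.X * P.L + P.T lev + 1 := by
  obtain ⟨h1, hcap⟩ := P.Xs_cap_facts lev
  refine ⟨by unfold Nh; exact_mod_cast h1, by unfold Nh; exact P.Xs_le_dbl lev, by unfold Nf Nh; push_cast; ring, ?_⟩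
  unfold Nh
  have h : P.Xs lev * (P.T lev + 1) ≤ 4 * P.X * P.L + (P.T lev + 1) := by
    calc P.Xs lev * (P.T lev + 1) ≤ (4 * P.X * P.L / (P.T lev + 1) + 1) * (P.T lev + 1) := Nat.mul_le_mul_right _ hcap
      _ = 4 * P.X * P.L / (P.T lev + 1) * (P.T lev + 1) + (P.T lev + 1) := by ring
      _ ≤ 4 * P.X * P.L + (P.T lev + 1) := Nat.add_le_add_right (Nat.div_mul_le_self _ _) _
  have h' : ((P.Xs lev * (P.T lev + 1) : ℕ) : ℝ) ≤ ((4 * P.X * P.L + (P.T lev + 1) : ℕ) : ℝ) := by exact_mod_cast h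
  push_cast at h'
  linarith

/-- the odd-node WEIGHTS at `lev ≥ 1`: `0 ≤ wl lev`, `0 ≤ γb lev`, `γb lev·Nh lev ≤ X·L`, `wl lev·Nh lev ≤ X·L` (the weight's `2^{−lev}` against
the range's `2^{lev}`; `e^{−(G+2)} ≤ 1`). [folklore] -/
theorem weights_Nh_leO (lev : ℕ) (hlev : 1 ≤ lev) :
    0 ≤ P.wl lev ∧ 0 ≤ P.γb lev ∧ P.γb lev * P.Nh lev ≤ (P.X : ℝ) * P.L ∧ P.wl lev * P.Nh lev ≤ (P.X : ℝ) * P.L := by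
  obtain ⟨l, rfl⟩ : ∃ l, lev = l + 1 := ⟨lev - 1, by omega⟩
  have hwl0 := (P.wl_facts (l + 1)).2
  have hγ : P.γb (l + 1) = P.wl l / 2 := (P.γb_facts l).2.1
  have hwl1 : P.wl (l + 1) = P.wl l / 2 := (P.wl_facts l).1
  obtain ⟨-, hNh, -, -⟩ := P.Nh_realO (l + 1)
  have hL := P.L_real
  have hX := P.X_floors.2.1
  -- `wl l ≤ L/2^l`
  have hw : P.wl l ≤ (P.L : ℝ) / 2 ^ l := by
    unfold wl
    have he : Real.exp (-(G n + 2)) ≤ 1 := Real.exp_le_one_iff.mpr (by linarith [G_pos n])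
    have : (P.L : ℝ) * Real.exp (-(G n + 2)) ≤ P.L := by nlinarith [Real.exp_pos (-(G n + 2))]
    exact div_le_div_of_nonneg_right this (by positivity)
  have h2l : (0 : ℝ) < 2 ^ l := by positivity
  -- `(L/2^l/2)·(2^{l+1} X/2 + 1) = L·X/2 + L/2^{l+1} ≤ X·L`
  have hkey : (P.L : ℝ) / 2 ^ l / 2 * (2 ^ (l + 1) * P.X / 2 + 1) ≤ P.X * P.L := by
    rw [pow_succ]
    have e : (P.L : ℝ) / 2 ^ l / 2 * (2 ^ l * 2 * P.X / 2 + 1) = P.L * P.X / 2 + P.L / (2 ^ l * 2) := by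
      field_simp
    rw [e]
    have h2l1 : (1 : ℝ) ≤ 2 ^ l := one_le_pow₀ (by norm_num)
    have : (P.L : ℝ) / (2 ^ l * 2) ≤ P.L / 2 := div_le_div_of_nonneg_left (by linarith) (by norm_num) (by nlinarith)
    nlinarith
  have hmain : P.wl l / 2 * (P.Nh (l + 1) : ℝ) ≤ P.X * P.L := by
    calc P.wl l / 2 * (P.Nh (l + 1) : ℝ) ≤ (P.L : ℝ) / 2 ^ l / 2 * (2 ^ (l + 1) * P.X / 2 + 1) := by
          have := (P.wl_facts l).2
          gcongr
      _ ≤ P.X * P.L := hkey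
  refine ⟨hwl0.le, by rw [hγ]; linarith [(P.wl_facts l).2], by rw [hγ]; exact hmain, by rw [hwl1]; exact hmain⟩

/-- at the pivot (last index) the `κ`-radius has no tail: `sRRK κ jl = 2·Bv jl + 3`, hence `LbRK κ lev jl ≤ 2·(2Bv jl + 3) ≤ 3·N·L + 6` and
`1 ≤ LbRK κ lev jl + 1`. [cite: Nesterenko2003, §3.5 (3.25); shape only] -/
theorem LbRK_last_leO (κ lev : ℕ) : P.sRRK κ P.jl = 2 * P.Bv P.jl + 3 ∧ (P.LbRK κ lev P.jl : ℝ) ≤ 3 * (P.N * P.L) + 6 ∧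
    (0 : ℝ) ≤ P.LbRK κ lev P.jl := by
  have hIoi : Finset.Ioi P.jl = ∅ := by
    ext j
    simp only [Finset.mem_Ioi, Finset.notMem_empty, iff_false, not_lt]
    have := j.isLt
    show j.val ≤ P.jl.val
    unfold jl; simp; omega
  have hs : P.sRRK κ P.jl = 2 * P.Bv P.jl + 3 := by unfold sRRK; rw [hIoi, Finset.sum_empty]; ring
  refine ⟨hs, ?_, by positivity⟩
  have h1 : P.LbRK κ lev P.jl ≤ 2 * (2 * P.Bv P.jl + 3) := by
    unfold LbRK; rw [hs]; exact Nat.div_le_self _ _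
  have h2 : (P.LbRK κ lev P.jl : ℝ) ≤ 2 * (2 * (P.Bv P.jl : ℝ) + 3) := by exact_mod_cast h1
  have h3 := (P.Bv_real P.jl).2.2.2
  linarith

/-- logs of the pivot box and the odd range: `log(LbRK κ lev jl + 1) ≤ 3 + WN + L/2^21` and `log(6·Nh lev) ≤ 2 + Sd·log 2 + X`,
`log(2·Nh lev + 1) ≤ 2 + Sd·log 2 + X` (`lev ≤ Sd`). [folklore] -/
theorem log_box_range_leO (κ lev : ℕ) (hlevS : lev ≤ P.Sd) :
    Real.log ((P.LbRK κ lev P.jl : ℝ) + 1) ≤ 3 + P.WN + P.L / 2 ^ 21 ∧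
      Real.log (6 * (P.Nh lev : ℝ)) ≤ 2 + P.Sd * Real.log 2 + P.X ∧
      Real.log (2 * (P.Nh lev : ℝ) + 1) ≤ 2 + P.Sd * Real.log 2 + P.X := by
  obtain ⟨-, hLb, hLb0⟩ := P.LbRK_last_leO κ lev
  obtain ⟨hNh1, hNh, -, -⟩ := P.Nh_realO lev
  obtain ⟨hlogL, hlogX, hlogN, hlogL0, hlogX0⟩ := P.log_letters_le
  have hN := P.N_facts
  have hL := P.L_real
  have hX := P.X_floors.2.1
  have hl2 : 0 < Real.log 2 := Real.log_pos one_lt_two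
  have hl2' : Real.log 2 < 1 := by have := Real.log_two_lt_d9; linarith
  refine ⟨?_, ?_, ?_⟩
  · -- `LbRK + 1 ≤ 3NL + 7 ≤ 10·N·L`
    have hNL : (1 : ℝ) ≤ P.N * P.L := one_le_mul_of_one_le_of_one_le hN.2.1 hL.1
    have h1 : (P.LbRK κ lev P.jl : ℝ) + 1 ≤ 10 * (P.N * P.L) := by linarith
    calc Real.log ((P.LbRK κ lev P.jl : ℝ) + 1) ≤ Real.log (10 * (P.N * P.L)) :=
          Real.log_le_log (by linarith) h1
      _ = Real.log 10 + Real.log P.N + Real.log P.L := by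
          rw [Real.log_mul (by norm_num) (by positivity), Real.log_mul hN.1.ne' (by linarith)]; ring
      _ ≤ 3 + P.WN + P.L / 2 ^ 21 := by
          have : Real.log 10 ≤ 3 := log_ten_le_threeO
          linarith
  · -- `6·Nh ≤ 6·(2^lev X/2 + 1) ≤ 6·2^lev·X`, `2^lev ≤ 2^Sd`
    have h2l : (1 : ℝ) ≤ 2 ^ lev := one_le_pow₀ (by norm_num)
    have h1 : 6 * (P.Nh lev : ℝ) ≤ 6 * (2 ^ lev * P.X) := by nlinarith
    calc Real.log (6 * (P.Nh lev : ℝ)) ≤ Real.log (6 * (2 ^ lev * P.X)) := Real.log_le_log (by linarith) h1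
      _ = Real.log 6 + lev * Real.log 2 + Real.log P.X := by
          rw [Real.log_mul (by norm_num) (by positivity), Real.log_mul (by positivity) (by linarith), Real.log_pow]; ring
      _ ≤ 2 + P.Sd * Real.log 2 + P.X := by
          have h6 : Real.log 6 ≤ 2 := by
            have he := Real.exp_one_gt_d9
            have e2 : Real.exp 1 ^ 2 = Real.exp 2 := by rw [Real.exp_one_pow]; norm_num
            have hp : (2.7182818283 : ℝ) ^ 2 ≤ Real.exp 1 ^ 2 := pow_le_pow_left₀ (by norm_num) he.le 2
            have hc : (6 : ℝ) ≤ (2.7182818283 : ℝ) ^ 2 := by norm_num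
            calc Real.log 6 ≤ Real.log (Real.exp 2) := Real.log_le_log (by norm_num) (by rw [← e2]; linarith)
              _ = 2 := Real.log_exp 2
          have hlev : (lev : ℝ) * Real.log 2 ≤ P.Sd * Real.log 2 := by
            have : (lev : ℝ) ≤ P.Sd := by exact_mod_cast hlevS
            nlinarith
          linarith
  · have h2l : (1 : ℝ) ≤ 2 ^ lev := one_le_pow₀ (by norm_num)
    have h1 : 2 * (P.Nh lev : ℝ) + 1 ≤ 6 * (2 ^ lev * P.X) := by nlinarith
    calc Real.log (2 * (P.Nh lev : ℝ) + 1) ≤ Real.log (6 * (2 ^ lev * P.X)) := Real.log_le_log (by linarith) h1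
      _ = Real.log 6 + lev * Real.log 2 + Real.log P.X := by
          rw [Real.log_mul (by norm_num) (by positivity), Real.log_mul (by positivity) (by linarith), Real.log_pow]; ring
      _ ≤ 2 + P.Sd * Real.log 2 + P.X := by
          have h6 : Real.log 6 ≤ 2 := by
            have he := Real.exp_one_gt_d9
            have e2 : Real.exp 1 ^ 2 = Real.exp 2 := by rw [Real.exp_one_pow]; norm_num
            have hp : (2.7182818283 : ℝ) ^ 2 ≤ Real.exp 1 ^ 2 := pow_le_pow_left₀ (by norm_num) he.le 2
            have hc : (6 : ℝ) ≤ (2.7182818283 : ℝ) ^ 2 := by norm_num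
            calc Real.log 6 ≤ Real.log (Real.exp 2) := Real.log_le_log (by norm_num) (by rw [← e2]; linarith)
              _ = 2 := Real.log_exp 2
          have hlev : (lev : ℝ) * Real.log 2 ≤ P.Sd * Real.log 2 := by
            have : (lev : ℝ) ≤ P.Sd := by exact_mod_cast hlevS
            nlinarith
          linarith

/-- `log DΔC Y T' = T'·(1 + log(1 + Y/T'))` for `Y ≥ 0`. [folklore] -/
theorem log_DΔC_eqO {Y : ℝ} (hY : 0 ≤ Y) (T' : ℕ) :
    Real.log (DΔC Y T') = (T' : ℝ) * (1 + Real.log (1 + Y / T')) := by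
  unfold DΔC
  have h1 : 0 < 1 + Y / (T' : ℝ) := by positivity
  rw [Real.log_pow, Real.log_mul (Real.exp_pos 1).ne' h1.ne', Real.log_exp]

/-- `log WC H ex L₀ Nord ρ = ex·Nord·log 2 + H/e + L₀·(1 + log(1 + 2^ex·ρ/H))` for `ρ ≥ 0`. [folklore] -/
theorem log_WC_eqO (H ex L₀ Nord : ℕ) {ρ : ℝ} (hρ : 0 ≤ ρ) :
    Real.log (WC H ex L₀ Nord ρ) =
      ((ex * Nord : ℕ) : ℝ) * Real.log 2 + (H : ℝ) / Real.exp 1 + (L₀ : ℝ) * (1 + Real.log (1 + (2 : ℝ) ^ ex * ρ / H)) := by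
  unfold WC
  have h1 : 0 < 1 + (2 : ℝ) ^ ex * ρ / H := by positivity
  have h2 : 0 < (Real.exp 1 * (1 + (2 : ℝ) ^ ex * ρ / H)) ^ L₀ := by positivity
  rw [Real.log_mul (by positivity) (by positivity), Real.log_mul (Real.exp_pos _).ne' h2.ne', Real.log_pow, Real.log_pow,
    Real.log_mul (Real.exp_pos 1).ne' h1.ne', Real.log_exp, Real.log_exp]
  ring

/-- **`cUR ≤ Z/40`** (`n ≥ 2`; from p1's `cUR_le`). [cite: Nesterenko2003, §3.5 (3.22)–(3.23); shape only] -/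
theorem cUR_le_ZO (hn : 2 ≤ n) : P.cUR ≤ P.Z / 40 ∧ 0 ≤ P.cUR := by
  obtain ⟨hc, hc0⟩ := P.cUR_le
  obtain ⟨hLZ, hXLZ, hXZ, hLWZ, hWNZ, hZ1⟩ := P.currenciesO' hn
  obtain ⟨hZ, hL, hXL, hLW, hnXL, hG⟩ := P.currenciesO hn
  have hy98 : (98 : ℝ) ≤ yloadK n := by
    have := yloadK_ge (n := n) (by omega); have hG' : G n = 8 * (n + 1) := G_eq n
    have hn2 : (2 : ℝ) ≤ n := by exact_mod_cast hn
    nlinarith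
  refine ⟨?_, hc0⟩
  have hn' : (2 : ℝ) ≤ n := by exact_mod_cast hn
  have hL1 := P.L_real.1
  have hX8 := P.eight_WN_le_X
  -- `n·WN ≤ n·X/8 ≤ (n+1)·X·L/8 = Z/64`
  have h1 : (n : ℝ) * P.WN ≤ P.Z / 64 := by
    have : (n : ℝ) * P.X ≤ (n + 1) * (P.X * P.L) := by
      have hX0 : (0 : ℝ) ≤ P.X := Nat.cast_nonneg _
      nlinarith
    nlinarith
  -- `n·(L/2^21 + 1) ≤ 2·(n+1)·L ≤ Z/768`
  have h2 : (n : ℝ) * (P.L / 2 ^ 21 + 1) ≤ P.Z / 768 := by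
    have hdiv : (P.L : ℝ) / 2 ^ 21 ≤ P.L := div_le_self (by linarith) (one_le_pow₀ (by norm_num))
    have : (n : ℝ) * (P.L / 2 ^ 21 + 1) ≤ 2 * ((n : ℝ) + 1) * P.L := by nlinarith
    have h3 : ((n : ℝ) + 1) * P.L ≤ P.Z / 1536 := by
      have := mul_le_mul_of_nonneg_left hL (by positivity : (0:ℝ) ≤ (n:ℝ) + 1)
      have e : ((n : ℝ) + 1) * (P.Z / (512 * ((n : ℝ) + 1) ^ 2)) = P.Z / (512 * ((n : ℝ) + 1)) := by
        field_simp
      rw [e] at this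
      refine this.trans ?_
      rw [div_le_div_iff_of_pos_left hZ (by positivity) (by norm_num)]; nlinarith
    linarith
  have h3 : P.Z / (4 * yloadK n) ≤ P.Z / 392 := div_le_div_of_nonneg_left hZ.le (by norm_num) (by linarith)
  have h4 : (1 : ℝ) ≤ P.Z / 4608 := by linarith
  nlinarith

end ArchG3Rec

end Summit.ABC.StewartYu

end
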